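import Mathlib
import Summits.ValiantsHypothesis.ValiantsHypothesis.Theorems.PermanentalConesPermanentalHyperbolic
import Summits.ValiantsHypothesis.ValiantsHypothesis.Theorems.PermanentalConesPermanentalConeHardCoreLevelZero
import Summits.ValiantsHypothesis.ValiantsHypothesis.Theorems.PermanentalConesPermanentalConeHardAllOnesNotWitness
import Literature.AlgebraicGeometry.HyperbolicPolynomials.SmoothBoundary

/-!
# `PermanentalConeHard` (stmt-ValiantsHypothesis-8654) — the two-row member is
`(N-2)! · D_a e_{N-1}` (infrastructure for the no-go `stub_twoRowsNotWitness`, lead c3)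

Route `PermanentalCones` of `ValiantsHypothesis`, crux `PermanentalConeHard` (H+).  The permanental
polynomials `P_k = per[(Y)_{rows<k}; x^{(N-k)}]` are the permanents of the matrices
`Matrix.of fun a b : Fin N => if (a : ℕ) < k then C (Y a b) else X b` over
`MvPolynomial (Fin N) ℝ`.  For the two-row choice `Y₀ = 𝟙`, `Y₁ = a` the member is computed
exactly:

* `TwoRows.rowPermanent_one_eq`: if `Y₀ = 𝟙` then `P_1 = (N-1)! · e_{N-1}(x)` — Gurvits' row
  recursion `sum_C_mul_pderiv_rowPermanent` at `k = 0` (`∑ⱼ ∂ⱼ P_0 = N • P_1`) applied to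
  `P_0 = N! · e_N` (`LevelZero.rowPermanent_eq`, `AllOnes.esymm_fin_self`) and the Euler-type
  identity `∑ⱼ ∂ⱼ e_N = e_{N-1}` (`AllOnes.sum_pderiv_esymm_succ`);
* `TwoRows.smul_rowPermanent_two_eq`: `(N-1) • P_2 = (N-1)! · ∑ⱼ Y₁ⱼ ∂ⱼ e_{N-1}` (the recursion
  at `k = 1`, `#{a : 1 ≤ a} = N - 1`);
* `stub_rowPermanent_two_eval` (registered): evaluating at `z` and cancelling `N - 1`,
  `P_2(z) = (N-2)! · ∑ⱼ aⱼ ∂ⱼe_{N-1}(z) = (N-2)! · gradForm e_{N-1} z a`.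

References: L. Gurvits, *Van der Waerden/Schrijver–Valiant like conjectures and stable (aka
hyperbolic) homogeneous polynomials: one theorem for all*, Electron. J. Combin. 15 (2008), §2
(the polarisation recursion); the computation here is elementary and proved in full.
-/

set_option linter.dupNamespace false

noncomputable section

namespace Summit.ValiantsHypothesis.ValiantsHypothesis.Theorems.PermanentalConesPermanentalConeHard

open MvPolynomial Finset
open scoped BigOperators
open Literature.AlgebraicGeometry.HyperbolicPolynomials

namespace TwoRows

/-- `#{a : Fin N | k ≤ a} = N - k` (the number of variable rows of `P_k`). [folklore] -/
theorem card_filter_le_val (N k : ℕ) :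
    (univ.filter (fun a : Fin N => k ≤ (a : ℕ))).card = N - k := by
  have h : univ.filter (fun a : Fin N => k ≤ (a : ℕ)) =
      (univ.filter (fun a : Fin N => (a : ℕ) < k))ᶜ := by
    ext a
    simp only [Finset.mem_filter, Finset.mem_univ, true_and, Finset.mem_compl, not_lt]
  rw [h, Finset.card_compl, Fin.card_filter_val_lt, Fintype.card_fin]
  omega

/-- **One constant row of ones.** If `Y₀ = 𝟙` then
`per[(Y)_{rows<1}; x^{(N-1)}] = (N-1)! · e_{N-1}(x)`: Gurvits' row recursion at `k = 0`
(`∑ⱼ Y₀ⱼ ∂ⱼ P_0 = N • P_1`) applied to `P_0 = N! · e_N`, together with `∑ⱼ ∂ⱼ e_N = e_{N-1}`,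
and cancellation of the factor `N`. [cite: Gurvits2008, §2] -/
theorem rowPermanent_one_eq {N : ℕ} (hN : 0 < N) (Y : Fin N → Fin N → ℝ)
    (hY : ∀ j, Y ⟨0, hN⟩ j = 1) :
    (Matrix.of fun i j : Fin N =>
        if (i : ℕ) < 1 then C (Y i j) else (X j : MvPolynomial (Fin N) ℝ)).permanent =
      C ((Nat.factorial (N - 1) : ℕ) : ℝ) * MvPolynomial.esymm (Fin N) ℝ (N - 1) := by
  obtain ⟨n, rfl⟩ : ∃ n, N = n + 1 := ⟨N - 1, by omega⟩
  rw [Nat.add_sub_cancel]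
  -- the recursion at `k = 0`: `∑ⱼ Y₀ⱼ ∂ⱼ P_0 = ∑_{a ≥ 0} P_1`, with `P_0 = (n+1)! · e_{n+1}`
  have hrec := sum_C_mul_pderiv_rowPermanent (R := ℝ) Y hN
  rw [LevelZero.rowPermanent_eq (n + 1) Y, ← AllOnes.esymm_fin_self, Finset.sum_const,
    card_filter_le_val, Nat.sub_zero] at hrec
  simp only [hY, C_1, one_mul, pderiv_C_mul] at hrec
  rw [← Finset.mul_sum, AllOnes.sum_pderiv_esymm_succ, Fintype.card_fin, Nat.add_sub_cancel_left,
    one_nsmul] at hrec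
  -- `hrec : C (n+1)! * e_n = (n + 1) • P_1`; cancel the factor `n + 1 = C (n + 1)`
  have hC : (C ((n + 1 : ℕ) : ℝ) : MvPolynomial (Fin (n + 1)) ℝ) ≠ 0 :=
    C_ne_zero.2 (Nat.cast_ne_zero.2 (Nat.succ_ne_zero n))
  refine mul_left_cancel₀ hC ?_
  rw [← mul_assoc, ← map_mul, ← Nat.cast_mul, ← Nat.factorial_succ, hrec, nsmul_eq_mul, map_natCast]

/-- **Two constant rows.** If `Y₀ = 𝟙` then
`(N-1) • per[(Y)_{rows<2}; x^{(N-2)}] = (N-1)! · ∑ⱼ Y₁ⱼ ∂ⱼ e_{N-1}`: the row recursion at `k = 1`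
(`∑ⱼ Y₁ⱼ ∂ⱼ P_1 = #{a : 1 ≤ a} • P_2`, `#{a : 1 ≤ a} = N - 1`) applied to
`P_1 = (N-1)! · e_{N-1}`. [cite: Gurvits2008, §2] -/
theorem smul_rowPermanent_two_eq {N : ℕ} (hN : 1 < N) (Y : Fin N → Fin N → ℝ)
    (hY : ∀ j, Y ⟨0, Nat.zero_lt_of_lt hN⟩ j = 1) :
    (N - 1) • (Matrix.of fun i j : Fin N =>
        if (i : ℕ) < 2 then C (Y i j) else (X j : MvPolynomial (Fin N) ℝ)).permanent =
      C ((Nat.factorial (N - 1) : ℕ) : ℝ) *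
        ∑ j, C (Y ⟨1, hN⟩ j) * pderiv j (MvPolynomial.esymm (Fin N) ℝ (N - 1)) := by
  have hrec := sum_C_mul_pderiv_rowPermanent (R := ℝ) Y hN
  rw [rowPermanent_one_eq (Nat.zero_lt_of_lt hN) Y hY, Finset.sum_const, card_filter_le_val] at hrec
  simp only [pderiv_C_mul] at hrec
  rw [← hrec, Finset.mul_sum]
  exact Finset.sum_congr rfl fun j _ => by ring

end TwoRows

/-- Registered form (`stub_rowPermanent_two_eval`): the two-row member of the permanental family
with rows `Y₀ = 𝟙`, `Y₁ = a` (and `N - 2` variable rows) evaluates to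
`per[(𝟙; a)_{rows<2}; z^{(N-2)}] = (N-2)! · ⟨∇e_{N-1}(z), a⟩ = (N-2)! · gradForm e_{N-1} z a`
(`TwoRows.smul_rowPermanent_two_eq` evaluated at `z`, divided by `N - 1`).
[cite: Gurvits2008, §2] -/
theorem stub_rowPermanent_two_eval : ∀ (N : ℕ), 2 ≤ N → ∀ (a z : Fin N → ℝ), MvPolynomial.eval z (Matrix.of fun i j : Fin N => if (i : ℕ) < 2 then MvPolynomial.C (if (i : ℕ) = 0 then (1 : ℝ) else a j) else MvPolynomial.X j).permanent = ((N - 2).factorial : ℝ) * gradForm (MvPolynomial.esymm (Fin N) ℝ (N - 1)) z a := by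
  intro N hN a z
  obtain ⟨n, rfl⟩ : ∃ n, N = n + 2 := ⟨N - 2, by omega⟩
  -- the two-row identity for `Y = (𝟙; a; …)`
  have h2 := TwoRows.smul_rowPermanent_two_eq hN
    (fun i j : Fin (n + 2) => if (i : ℕ) = 0 then (1 : ℝ) else a j) (fun _ => rfl)
  have e1 : n + 2 - 1 = n + 1 := rfl
  rw [e1] at h2
  rw [e1, Nat.add_sub_cancel]
  -- evaluate at `z`
  have h2' := congrArg (MvPolynomial.eval z) h2
  simp only [nsmul_eq_mul, map_mul, map_natCast, eval_C, map_sum, Nat.one_ne_zero, if_false] at h2'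
  have hg : gradForm (MvPolynomial.esymm (Fin (n + 2)) ℝ (n + 1)) z a =
      ∑ j, a j * MvPolynomial.eval z (pderiv j (MvPolynomial.esymm (Fin (n + 2)) ℝ (n + 1))) := rfl
  -- cancel `n + 1`, using `(n+1)! = (n+1) · n!`
  refine mul_left_cancel₀ (Nat.cast_ne_zero.2 (Nat.succ_ne_zero n) : ((n + 1 : ℕ) : ℝ) ≠ 0) ?_
  rw [h2', hg, ← mul_assoc, ← Nat.cast_mul, ← Nat.factorial_succ]

end Summit.ValiantsHypothesis.ValiantsHypothesis.Theorems.PermanentalConesPermanentalConeHard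

end
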